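import Literature.Computation.Certificates.SemidefiniteRigorousBounds
import HarnessLib

/-!
# Rigorous SDP lower bound with a negative-part split of the dual multiplier (operator-norm penalty)

Topic `Literature/Computation/Certificates`; companion of `SemidefiniteRigorousBounds.lean`
([JanssonChaykinKeil2008] Lemma 3.1 / Thm 3.2, inequality form `JanssonChaykinKeil.lmiForm_bound`)
and of `SemidefiniteRigorousBoundsEigenCount.lean` ([Jansson2007] Cor. 6.1: the penalty
`l · d⁻ · x̄` with `l` the number of negative eigenvalues of the dual slack matrix).

Sources.  C. Jansson, D. Chaykin, C. Keil, *Rigorous error bounds for the optimal value in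
semidefinite programming*, SIAM J. Numer. Anal. 46 (2007/08) 180–200 [JanssonChaykinKeil2008],
Lemma 3.1 and Theorem 3.2; C. Jansson, *Guaranteed accuracy for conic programming problems in vector
lattices*, arXiv:0707.4366 (2007) [Jansson2007], Lemma 4.1 (`⟨d, x⟩ ≥ ⟨d⁻, x̄⟩` for
`0 ≤ x ≤ x̄`, `d⁻ ≤ inf{d, 0}` the negative part of `d`) with Theorem 4.1 (a) (both p. 8 = p0008) and its
SDP specialisation Corollary 6.1 (a) (p. 13 = p0013).

What this file adds is the CERTIFICATE form of [Jansson2007, Lemma 4.1] for the cone of positive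
semidefinite matrices: instead of the negative part `D⁻ = Σ_{λ_i(D) < 0} λ_i v_i v_iᵀ` of the dual
multiplier (which a verifier cannot compute exactly) the certificate carries ANY split
`Z = P − W Wᵀ` with `P ⪰ d · 1` certified by the usual means (Gram factors, dyadic residual floors) and
an explicit factor `W`; the a-priori information on the primal block is an operator bound
`M ⪯ x̄ · 1` (`λ_max(M) ≤ x̄`).  Then

  `⟨Z, M⟩ = ⟨P, M⟩ − tr(Wᵀ M W) ≥ d · tr M − x̄ · tr(Wᵀ W)`        (`0 ⪯ M ⪯ x̄ · 1`),

because `Wᵀ (x̄ · 1 − M) W ⪰ 0`.  With `W` the (rounded) negative part of a float multiplier,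
`tr(Wᵀ W) = Σ_{λ_i < 0} |λ_i| ≤ l · |λ_min⁻|`, so the penalty `x̄ · tr(WᵀW)` is at least as sharp as
Cor. 6.1 (a)'s `l · |d⁻| · x̄` and replaces the trace-bound penalty `|d⁻| · τ` (`τ ≥ tr M`, `τ ≤ s · x̄`)
of Lemma 3.1 / `lmiForm_bound` for that part of the multiplier.  No eigenvalue or inertia of `Z` is
certified: the verifier checks `P = Z + W Wᵀ ⪰ d · 1` exactly as it checks `Z ⪰ d · 1` today.

## Main statements

* `trace_transpose_mul_mul_le` — `tr(Wᵀ M W) ≤ x̄ · tr(Wᵀ W)` for `x̄ · 1 − M ⪰ 0` (any `W`);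
  `trace_le_card_mul_of_sub_posSemidef` — `tr M ≤ s · x̄` from the same hypothesis.
* `JanssonChaykinKeil.trace_mul_ge_negSplit` — the display above: `(Z + W Wᵀ − d · 1) ⪰ 0`, `M ⪰ 0`,
  `x̄ · 1 − M ⪰ 0` give `d · tr M − x̄ · tr(Wᵀ W) ≤ ⟨Z, M⟩`.  (With `W = 0` this is
  `JanssonChaykinKeil.trace_mul_ge`, Lemma 3.1 in trace form.)
* `JanssonChaykinKeil.lmiForm_bound_negSplit` — `lmiForm_bound` (the bound formula of the conic
  certificate verifiers) with, per PSD block `k`, the extra a-priori hypothesis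
  `x̄_k · 1 − M_k(y) ⪰ 0`, the certificate hypothesis `Z_k + W_k W_kᵀ − d_k · 1 ⪰ 0` in place of
  `Z_k − d_k · 1 ⪰ 0`, and the extra penalty `Σ_k x̄_k · tr(W_kᵀ W_k)`:
  `β − Σ_{v ≠ u} |r_v| ρ_v − Σ_k |min(0, d_k)| τ_k − Σ_k x̄_k tr(W_kᵀ W_k) ≤ c · y + c₀`, the residuals
  `r_v` and the constant `β` being computed with the multipliers `Z_k` exactly as in `lmiForm_bound`.
* `JanssonChaykinKeil.lmiForm_bound_negSplit_card` — the same without trace bounds: the floor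
  penalty is `|min(0, d_k)| · s_k · x̄_k` (`s_k` the block dimension), as in Lemma 3.1 as printed.
* `JanssonChaykinKeil.lmiForm_enclosure_negSplit` — the optimal-value form: a split certificate and an
  exactly feasible point `ỹ` of the SAME program enclose the infimum of the objective over the feasible
  set, `β − penalties ≤ inf ≤ c · ỹ + c₀` ([JanssonChaykinKeil2008, Thm 3.2 with Thm 4.1]).

All matrices are real; `X ⪯ x̄ · 1` is `(x̄ • 1 − X).PosSemidef` as in the companion files.
-/

namespace Literature.Computation.Certificates

open Matrix
open scoped BigOperators

/-! ### The operator-norm estimate `tr(Wᵀ M W) ≤ x̄ · tr(Wᵀ W)` -/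

section NegPart

variable {n : Type*} [Fintype n] [DecidableEq n] {m : Type*} [Fintype m]

omit [DecidableEq n] in
/-- For real matrices, `trace (Wᵀ * M * W) = trace (W * Wᵀ * M)` (cyclicity; plumbing). [folklore] -/
private theorem trace_transpose_mul_mul_eq (M : Matrix n n ℝ) (W : Matrix n m ℝ) :
    trace (Wᵀ * M * W) = trace (W * Wᵀ * M) := by
  rw [Matrix.mul_assoc, Matrix.trace_mul_comm, Matrix.mul_assoc, Matrix.trace_mul_comm]

/-- **Operator-norm estimate.** If `x̄ · 1 − M ⪰ 0` (`λ_max(M) ≤ x̄`) then for every real `n × m`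
matrix `W`, `tr(Wᵀ M W) ≤ x̄ · tr(Wᵀ W)`, because `Wᵀ (x̄ · 1 − M) W ⪰ 0` has nonnegative trace.
This is the step `⟨D⁻, X⟩ ≥ ⟨D⁻, x̄ · I⟩` of [Jansson2007, Lemma 4.1 / proof of Cor. 6.1] written
for an explicit factor `W` of the subtracted part. [cite: Jansson2007, Lemma 4.1 (p0008) and Cor 6.1
(proof, p0013); certificate (factor) form] -/
theorem trace_transpose_mul_mul_le (M : Matrix n n ℝ) (W : Matrix n m ℝ) (xb : ℝ)
    (hx : (xb • (1 : Matrix n n ℝ) - M).PosSemidef) :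
    trace (Wᵀ * M * W) ≤ xb * trace (Wᵀ * W) := by
  have h := (hx.conjTranspose_mul_mul_same W).trace_nonneg
  rw [conjTranspose_eq_transpose_of_trivial, Matrix.mul_sub, Matrix.sub_mul, Matrix.trace_sub,
    Matrix.mul_smul, Matrix.mul_one, Matrix.smul_mul, Matrix.trace_smul, smul_eq_mul] at h
  linarith

/-- `tr M ≤ s · x̄` when `x̄ · 1 − M ⪰ 0` (`λ_max(M) ≤ x̄`), `s` the dimension: the trace bound
implied by an operator bound (plumbing; the step `tr X ≤ s · x̄` of Lemma 3.1).
[cite: JanssonChaykinKeil2008, Lemma 3.1 (proof)] -/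
theorem trace_le_card_mul_of_sub_posSemidef {M : Matrix n n ℝ} {xb : ℝ}
    (h : (xb • (1 : Matrix n n ℝ) - M).PosSemidef) : trace M ≤ Fintype.card n * xb := by
  have h0 := h.trace_nonneg
  rw [Matrix.trace_sub, Matrix.trace_smul, Matrix.trace_one, smul_eq_mul] at h0
  linarith

end NegPart

namespace JanssonChaykinKeil

/-! ### Lemma 3.1 in trace form with a negative-part split -/

section Lemma31NegSplit

variable {n : Type*} [Fintype n] [DecidableEq n] {m : Type*} [Fintype m]

/-- **Lemma 3.1 (trace form) with a negative-part split of the multiplier.** If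
`Z + W Wᵀ − d · 1 ⪰ 0` (the certified part `P = Z + W Wᵀ` has `λ_min(P) ≥ d`), `M ⪰ 0` and
`x̄ · 1 − M ⪰ 0`, then `⟨Z, M⟩ = tr(Z M) ≥ d · tr M − x̄ · tr(Wᵀ W)`.  With `W = 0` this is
`trace_mul_ge` ([JanssonChaykinKeil2008, Lemma 3.1, proof]); with `W` the negative part of a
symmetric `D` and `P = D⁺` (`d = 0`) it is `⟨D, X⟩ ≥ −x̄ · Σ_{λ_i(D)<0} |λ_i(D)|`, the SDP case of
[Jansson2007, Lemma 4.1 / Thm 4.1 (a)], which Cor. 6.1 (a) coarsens to `l · d⁻ · x̄`.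
[cite: JanssonChaykinKeil2008, Lemma 3.1; Jansson2007, Lemma 4.1 and Thm 4.1 (a) (p0008), Cor 6.1 (a)
(p0013); certificate (split) form] -/
theorem trace_mul_ge_negSplit {Z M : Matrix n n ℝ} {W : Matrix n m ℝ} {d xb : ℝ}
    (hZ : (Z + W * Wᵀ - d • (1 : Matrix n n ℝ)).PosSemidef) (hM : M.PosSemidef)
    (hx : (xb • (1 : Matrix n n ℝ) - M).PosSemidef) :
    d * trace M - xb * trace (Wᵀ * W) ≤ trace (Z * M) := by
  have h1 := trace_mul_ge hZ hM
  have h2 := trace_transpose_mul_mul_le M W xb hx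
  rw [Matrix.add_mul, Matrix.trace_add, ← trace_transpose_mul_mul_eq] at h1
  linarith

end Lemma31NegSplit

/-! ### The inequality (LMI) form with the split, as used by conic certificate verifiers -/

section LMIFormNegSplit

variable {V : Type*} [Fintype V] [DecidableEq V] {E : Type*} [Fintype E] {I : Type*} [Fintype I]
  {K : Type*} [Fintype K] {σ : K → Type*} [∀ k, Fintype (σ k)] [∀ k, DecidableEq (σ k)]
  {ω : K → Type*} [∀ k, Fintype (ω k)]

/-- `|min(0,d)| · τ = −(min(d,0) · τ)` (plumbing). [folklore] -/
private theorem abs_min_zero_mul' (d τ : ℝ) : |min 0 d| * τ = -(min d 0 * τ) := by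
  rw [min_comm, abs_of_nonpos (min_le_right d 0)]
  ring

/-- **Rigorous lower bound in inequality form with negative-part splits.** Data as in
`lmiForm_bound`: objective `c·y + c₀`, unit variable `y_u = 1`, a-priori bounds `|y_v| ≤ ρ_v`
(`v ≠ u`), equality rows, inequality rows, PSD blocks `M_k(y) = C_k + Σ_v y_v F_{k,v} ⪰ 0` with trace
bounds `tr M_k(y) ≤ τ_k`, and IN ADDITION a-priori operator bounds `M_k(y) ⪯ x̄_k · 1` on the feasible
set.  Certificate: multipliers `λ_r` (free), `κ_i ≥ 0`, matrices `Z_k` together with factors `W_k`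
(`σ_k × ω_k`) and floors `d_k` such that `Z_k + W_k W_kᵀ − d_k · 1 ⪰ 0` (the verifier certifies the
part `P_k = Z_k + W_k W_kᵀ` exactly as it certifies a multiplier today).  With the exact residuals
`r_v = c_v − Σ_r λ_r row_r[v] + Σ_i κ_i row_i[v] − Σ_k ⟨Z_k, F_{k,v}⟩` and
`β = c₀ + r_u + Σ_r λ_r rhs_r − Σ_i κ_i upper_i − Σ_k ⟨Z_k, C_k⟩` (computed with `Z_k` itself),
every feasible `y` satisfies
`c·y + c₀ ≥ β − Σ_{v ≠ u} |r_v| ρ_v − Σ_k |min(0, d_k)| τ_k − Σ_k x̄_k · tr(W_kᵀ W_k)`.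
(Proof: the objective identity of `lmiForm_bound` and `trace_mul_ge_negSplit` per block.)  With all
`W_k = 0` this is `lmiForm_bound`; the last penalty is at most `Σ_k x̄_k · l_k · |λ_min⁻(Z_k)|` when
`W_k` carries the `l_k` negative eigen-directions of `Z_k` ([Jansson2007, Cor. 6.1 (a)]).
[cite: JanssonChaykinKeil2008, Lemma 3.1 and Thm 3.2; Jansson2007, Lemma 4.1 and Thm 4.1 (a) (p0008),
Cor 6.1 (a) (p0013) (inequality-form corollary with certificate splits `Z_k = P_k − W_k W_kᵀ`)] -/
theorem lmiForm_bound_negSplit (c : V → ℝ) (c0 : ℝ) (u : V)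
    (rowE : E → V → ℝ) (rhs : E → ℝ) (rowI : I → V → ℝ) (upper : I → ℝ)
    (Cb : ∀ k, Matrix (σ k) (σ k) ℝ) (F : ∀ k, V → Matrix (σ k) (σ k) ℝ)
    (ρ : V → ℝ) (τ : K → ℝ) (xb : K → ℝ)
    -- a feasible point
    {y : V → ℝ} (hyu : y u = 1) (hρ : ∀ v, v ≠ u → |y v| ≤ ρ v)
    (heq : ∀ r, ∑ v, rowE r v * y v = rhs r) (hineq : ∀ i, ∑ v, rowI i v * y v ≤ upper i)
    (hpsd : ∀ k, (Cb k + ∑ v, y v • F k v).PosSemidef)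
    (hτ : ∀ k, trace (Cb k + ∑ v, y v • F k v) ≤ τ k)
    (hxb : ∀ k, (xb k • (1 : Matrix (σ k) (σ k) ℝ) - (Cb k + ∑ v, y v • F k v)).PosSemidef)
    -- the certificate
    (lam : E → ℝ) (κ : I → ℝ) (hκ : ∀ i, 0 ≤ κ i) (Z : ∀ k, Matrix (σ k) (σ k) ℝ)
    (W : ∀ k, Matrix (σ k) (ω k) ℝ) (dZ : K → ℝ)
    (hZ : ∀ k, (Z k + W k * (W k)ᵀ - dZ k • (1 : Matrix (σ k) (σ k) ℝ)).PosSemidef)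
    (r : V → ℝ)
    (hr : ∀ v, r v = c v - ∑ e, lam e * rowE e v + ∑ i, κ i * rowI i v - ∑ k, trace (Z k * F k v))
    (β : ℝ)
    (hβ : β = c0 + r u + ∑ e, lam e * rhs e - ∑ i, κ i * upper i - ∑ k, trace (Z k * Cb k)) :
    β - ∑ v ∈ Finset.univ.erase u, |r v| * ρ v - ∑ k, |min 0 (dZ k)| * τ k
      - ∑ k, xb k * trace ((W k)ᵀ * W k) ≤ ∑ v, c v * y v + c0 := by
  -- Step 1: rewrite the objective through the residuals (verbatim from `lmiForm_bound`)
  have hc : ∀ v, c v = r v + ∑ e, lam e * rowE e v - ∑ i, κ i * rowI i v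
      + ∑ k, trace (Z k * F k v) := by
    intro v; rw [hr v]; ring
  have h1 : ∑ v, c v * y v = ∑ v, (r v * y v + (∑ e, lam e * rowE e v) * y v
      - (∑ i, κ i * rowI i v) * y v + (∑ k, trace (Z k * F k v)) * y v) := by
    refine Finset.sum_congr rfl fun v _ => ?_
    rw [hc v]; ring
  have hE : ∑ v, (∑ e, lam e * rowE e v) * y v = ∑ e, lam e * rhs e := by
    simp_rw [Finset.sum_mul]
    rw [Finset.sum_comm]
    refine Finset.sum_congr rfl fun e _ => ?_
    rw [← heq e, Finset.mul_sum]
    exact Finset.sum_congr rfl fun v _ => by ring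
  have hI : ∑ v, (∑ i, κ i * rowI i v) * y v = ∑ i, κ i * ∑ v, rowI i v * y v := by
    simp_rw [Finset.sum_mul]
    rw [Finset.sum_comm]
    refine Finset.sum_congr rfl fun i _ => ?_
    rw [Finset.mul_sum]
    exact Finset.sum_congr rfl fun v _ => by ring
  have hK : ∑ v, (∑ k, trace (Z k * F k v)) * y v = ∑ k, trace (Z k * ∑ v, y v • F k v) := by
    simp_rw [Finset.sum_mul]
    rw [Finset.sum_comm]
    refine Finset.sum_congr rfl fun k _ => ?_
    rw [Finset.mul_sum, Matrix.trace_sum]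
    refine Finset.sum_congr rfl fun v _ => ?_
    rw [Matrix.mul_smul, Matrix.trace_smul, smul_eq_mul, mul_comm]
  have hobj : ∑ v, c v * y v = ∑ v, r v * y v + ∑ e, lam e * rhs e
      - ∑ i, κ i * ∑ v, rowI i v * y v + ∑ k, trace (Z k * ∑ v, y v • F k v) := by
    rw [h1]
    simp only [Finset.sum_add_distrib, Finset.sum_sub_distrib]
    rw [hE, hI, hK]
  -- Step 2: the estimates for the residual part and the inequality rows (verbatim)
  have hres : r u - ∑ v ∈ Finset.univ.erase u, |r v| * ρ v ≤ ∑ v, r v * y v := by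
    rw [← Finset.add_sum_erase _ _ (Finset.mem_univ u), hyu, mul_one]
    have : -(∑ v ∈ Finset.univ.erase u, |r v| * ρ v) ≤ ∑ v ∈ Finset.univ.erase u, r v * y v := by
      rw [← Finset.sum_neg_distrib]
      refine Finset.sum_le_sum fun v hv => ?_
      have hvu : v ≠ u := Finset.ne_of_mem_erase hv
      have h1 := hρ v hvu
      have h2 : |r v * y v| ≤ |r v| * ρ v := by
        rw [abs_mul]; exact mul_le_mul_of_nonneg_left h1 (abs_nonneg _)
      have h3 := neg_abs_le (r v * y v)
      linarith
    linarith
  have hrows : ∑ i, κ i * ∑ v, rowI i v * y v ≤ ∑ i, κ i * upper i :=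
    Finset.sum_le_sum fun i _ => mul_le_mul_of_nonneg_left (hineq i) (hκ i)
  -- Step 2': the block estimate, now through `trace_mul_ge_negSplit`
  have hblocks : ∀ k, -(|min 0 (dZ k)| * τ k) - xb k * trace ((W k)ᵀ * W k) - trace (Z k * Cb k) ≤
      trace (Z k * ∑ v, y v • F k v) := by
    intro k
    have hsplit : trace (Z k * ∑ v, y v • F k v) =
        trace (Z k * (Cb k + ∑ v, y v • F k v)) - trace (Z k * Cb k) := by
      rw [Matrix.mul_add, Matrix.trace_add]; ring
    have h1 := trace_mul_ge_negSplit (hZ k) (hpsd k) (hxb k)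
    have h2 := (hpsd k).trace_nonneg
    have h3 := hτ k
    have h4 : min (dZ k) 0 * τ k ≤ dZ k * trace (Cb k + ∑ v, y v • F k v) := by
      rcases le_or_gt 0 (dZ k) with hdk | hdk
      · rw [min_eq_right hdk]; nlinarith
      · rw [min_eq_left hdk.le]; nlinarith
    rw [abs_min_zero_mul', hsplit]
    linarith
  have hsumblocks : -(∑ k, |min 0 (dZ k)| * τ k) - ∑ k, xb k * trace ((W k)ᵀ * W k)
      - ∑ k, trace (Z k * Cb k) ≤ ∑ k, trace (Z k * ∑ v, y v • F k v) := by
    have h := Finset.sum_le_sum fun k (_ : k ∈ Finset.univ) => hblocks k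
    simp only [Finset.sum_sub_distrib, Finset.sum_neg_distrib] at h
    exact h
  -- Step 3: assemble
  rw [hobj, hβ]
  linarith

/-- **The same bound without trace bounds**: when only the operator bounds `M_k(y) ⪯ x̄_k · 1` are
known, `tr M_k(y) ≤ s_k · x̄_k` (`s_k` the block dimension) supplies the trace bounds, and the floor
penalty reads `|min(0, d_k)| · s_k · x̄_k` — [JanssonChaykinKeil2008, Lemma 3.1] as printed
(`s · d⁻ · x̄`) for the certified part plus `x̄_k · tr(W_kᵀ W_k)` for the split part.
[cite: JanssonChaykinKeil2008, Lemma 3.1 and Thm 3.2; Jansson2007, Lemma 4.1 and Thm 4.1 (a) (p0008),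
Cor 6.1 (a) (p0013) (inequality-form corollary with certificate splits)] -/
theorem lmiForm_bound_negSplit_card (c : V → ℝ) (c0 : ℝ) (u : V)
    (rowE : E → V → ℝ) (rhs : E → ℝ) (rowI : I → V → ℝ) (upper : I → ℝ)
    (Cb : ∀ k, Matrix (σ k) (σ k) ℝ) (F : ∀ k, V → Matrix (σ k) (σ k) ℝ)
    (ρ : V → ℝ) (xb : K → ℝ)
    {y : V → ℝ} (hyu : y u = 1) (hρ : ∀ v, v ≠ u → |y v| ≤ ρ v)
    (heq : ∀ r, ∑ v, rowE r v * y v = rhs r) (hineq : ∀ i, ∑ v, rowI i v * y v ≤ upper i)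
    (hpsd : ∀ k, (Cb k + ∑ v, y v • F k v).PosSemidef)
    (hxb : ∀ k, (xb k • (1 : Matrix (σ k) (σ k) ℝ) - (Cb k + ∑ v, y v • F k v)).PosSemidef)
    (lam : E → ℝ) (κ : I → ℝ) (hκ : ∀ i, 0 ≤ κ i) (Z : ∀ k, Matrix (σ k) (σ k) ℝ)
    (W : ∀ k, Matrix (σ k) (ω k) ℝ) (dZ : K → ℝ)
    (hZ : ∀ k, (Z k + W k * (W k)ᵀ - dZ k • (1 : Matrix (σ k) (σ k) ℝ)).PosSemidef)
    (r : V → ℝ)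
    (hr : ∀ v, r v = c v - ∑ e, lam e * rowE e v + ∑ i, κ i * rowI i v - ∑ k, trace (Z k * F k v))
    (β : ℝ)
    (hβ : β = c0 + r u + ∑ e, lam e * rhs e - ∑ i, κ i * upper i - ∑ k, trace (Z k * Cb k)) :
    β - ∑ v ∈ Finset.univ.erase u, |r v| * ρ v - ∑ k, |min 0 (dZ k)| * (Fintype.card (σ k) * xb k)
      - ∑ k, xb k * trace ((W k)ᵀ * W k) ≤ ∑ v, c v * y v + c0 :=
  lmiForm_bound_negSplit c c0 u rowE rhs rowI upper Cb F ρ (fun k => Fintype.card (σ k) * xb k) xb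
    hyu hρ heq hineq hpsd (fun k => trace_le_card_mul_of_sub_posSemidef (hxb k)) hxb lam κ hκ Z W dZ hZ r hr β
    hβ

/-- **Two-sided enclosure of the optimal value with a split certificate.** For the program of
`lmiForm_bound_negSplit` whose trace bounds `τ_k` AND operator bounds `x̄_k` hold at every feasible
point (problem-side hypotheses `hτ`, `hxb`), a split lower certificate (`Z_k`, `W_k`, `d_k` with
`Z_k + W_k W_kᵀ − d_k · 1 ⪰ 0`) and an exactly feasible point `ỹ` give
`β − Σ_{v ≠ u} |r_v| ρ_v − Σ_k |min(0, d_k)| τ_k − Σ_k x̄_k tr(W_kᵀ W_k) ≤ inf ≤ c · ỹ + c₀`, `inf` the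
infimum of the objective over the feasible set (nonempty by `ỹ`, bounded below by the certificate).
[cite: JanssonChaykinKeil2008, Thm 3.2 and Thm 4.1; Jansson2007, Lemma 4.1 and Thm 4.1 (a) (p0008),
Cor 6.1 (a) (p0013) (optimal-value corollary of the split form)] -/
theorem lmiForm_enclosure_negSplit (c : V → ℝ) (c0 : ℝ) (u : V)
    (rowE : E → V → ℝ) (rhs : E → ℝ) (rowI : I → V → ℝ) (upper : I → ℝ)
    (Cb : ∀ k, Matrix (σ k) (σ k) ℝ) (F : ∀ k, V → Matrix (σ k) (σ k) ℝ)
    (ρ : V → ℝ) (τ : K → ℝ) (xb : K → ℝ)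
    -- trace bounds and operator bounds valid for every feasible point (problem-side hypotheses)
    (hτ : ∀ y : V → ℝ, y u = 1 → (∀ v, v ≠ u → |y v| ≤ ρ v) →
      (∀ e, ∑ v, rowE e v * y v = rhs e) → (∀ i, ∑ v, rowI i v * y v ≤ upper i) →
      (∀ k, (Cb k + ∑ v, y v • F k v).PosSemidef) → ∀ k, trace (Cb k + ∑ v, y v • F k v) ≤ τ k)
    (hxb : ∀ y : V → ℝ, y u = 1 → (∀ v, v ≠ u → |y v| ≤ ρ v) →
      (∀ e, ∑ v, rowE e v * y v = rhs e) → (∀ i, ∑ v, rowI i v * y v ≤ upper i) →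
      (∀ k, (Cb k + ∑ v, y v • F k v).PosSemidef) →
      ∀ k, (xb k • (1 : Matrix (σ k) (σ k) ℝ) - (Cb k + ∑ v, y v • F k v)).PosSemidef)
    -- the split lower certificate
    (lam : E → ℝ) (κ : I → ℝ) (hκ : ∀ i, 0 ≤ κ i) (Z : ∀ k, Matrix (σ k) (σ k) ℝ)
    (W : ∀ k, Matrix (σ k) (ω k) ℝ) (dZ : K → ℝ)
    (hZ : ∀ k, (Z k + W k * (W k)ᵀ - dZ k • (1 : Matrix (σ k) (σ k) ℝ)).PosSemidef)
    (r : V → ℝ)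
    (hr : ∀ v, r v = c v - ∑ e, lam e * rowE e v + ∑ i, κ i * rowI i v - ∑ k, trace (Z k * F k v))
    (β : ℝ)
    (hβ : β = c0 + r u + ∑ e, lam e * rhs e - ∑ i, κ i * upper i - ∑ k, trace (Z k * Cb k))
    -- the exactly feasible point
    {yt : V → ℝ} (hyu : yt u = 1) (hρt : ∀ v, v ≠ u → |yt v| ≤ ρ v)
    (heqt : ∀ e, ∑ v, rowE e v * yt v = rhs e) (hineqt : ∀ i, ∑ v, rowI i v * yt v ≤ upper i)
    (hpsdt : ∀ k, (Cb k + ∑ v, yt v • F k v).PosSemidef) :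
    β - ∑ v ∈ Finset.univ.erase u, |r v| * ρ v - ∑ k, |min 0 (dZ k)| * τ k
        - ∑ k, xb k * trace ((W k)ᵀ * W k) ≤
      sInf {val : ℝ | ∃ y : V → ℝ, y u = 1 ∧ (∀ v, v ≠ u → |y v| ≤ ρ v) ∧
        (∀ e, ∑ v, rowE e v * y v = rhs e) ∧ (∀ i, ∑ v, rowI i v * y v ≤ upper i) ∧
        (∀ k, (Cb k + ∑ v, y v • F k v).PosSemidef) ∧ val = ∑ v, c v * y v + c0} ∧
    sInf {val : ℝ | ∃ y : V → ℝ, y u = 1 ∧ (∀ v, v ≠ u → |y v| ≤ ρ v) ∧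
        (∀ e, ∑ v, rowE e v * y v = rhs e) ∧ (∀ i, ∑ v, rowI i v * y v ≤ upper i) ∧
        (∀ k, (Cb k + ∑ v, y v • F k v).PosSemidef) ∧ val = ∑ v, c v * y v + c0} ≤
      ∑ v, c v * yt v + c0 := by
  set S := {val : ℝ | ∃ y : V → ℝ, y u = 1 ∧ (∀ v, v ≠ u → |y v| ≤ ρ v) ∧
        (∀ e, ∑ v, rowE e v * y v = rhs e) ∧ (∀ i, ∑ v, rowI i v * y v ≤ upper i) ∧
        (∀ k, (Cb k + ∑ v, y v • F k v).PosSemidef) ∧ val = ∑ v, c v * y v + c0} with hS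
  -- every feasible value is bounded below by the certificate's number
  have hlow : ∀ val ∈ S, β - ∑ v ∈ Finset.univ.erase u, |r v| * ρ v - ∑ k, |min 0 (dZ k)| * τ k
      - ∑ k, xb k * trace ((W k)ᵀ * W k) ≤ val := by
    rintro val ⟨y, hyu', hρ', heq', hineq', hpsd', rfl⟩
    exact lmiForm_bound_negSplit c c0 u rowE rhs rowI upper Cb F ρ τ xb hyu' hρ' heq' hineq' hpsd'
      (hτ y hyu' hρ' heq' hineq' hpsd') (hxb y hyu' hρ' heq' hineq' hpsd') lam κ hκ Z W dZ hZ r hr β hβ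
  have hne : S.Nonempty := ⟨_, yt, hyu, hρt, heqt, hineqt, hpsdt, rfl⟩
  have hbdd : BddBelow S := ⟨_, hlow⟩
  exact ⟨le_csInf hne hlow, csInf_le hbdd ⟨yt, hyu, hρt, heqt, hineqt, hpsdt, rfl⟩⟩

end LMIFormNegSplit

end JanssonChaykinKeil

end Literature.Computation.Certificates
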